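import Literature.AnabelianGeometry.SemiGraphs.TemperedAnabelian
import Literature.AnabelianGeometry.EtaleTheta.Discharge.Sec2ProfiniteCompletion
import Mathlib.Topology.Algebra.Category.ProfiniteGrp.Completion
import Mathlib.Topology.Algebra.OpenSubgroup
import HarnessLib

/-!
# [SemiAnbd] §6 p. 69 "the profinite completion `∧`": Mathlib's profinite completion of a discrete group,
# and products of profinite completions, satisfy the interface predicate `IsProfiniteCompletion`
# (proof-only bricks)

Mochizuki, *Semi-graphs of anabelioids*, Publ. RIMS **42** (2006) [SemiAnbd], §6 p. 69: "we shall denote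
the profinite completion of a group by means of a `∧`" [cite: MochizukiSemiAnbd2006, §6 p.69]; [EtTh] §1
p. 12 "`Π_X := (Π^tp_X)^∧`".  abc-iut cell, wave-5 prover seat abc-iut-w5-d218 (gen 2); PROOF-ONLY (no
definition, no named fact; nothing of another seat is edited or restated).

The L3 interface predicate `SemiGraphs.IsProfiniteCompletion (ι : F →ₜ* F̂)` (FROZEN,
`TemperedAnabelian.lean`, abc-iut-L3-t2) is the field `isProfiniteCompletion_toHat` of every
`TemperedCurve` / `ThetaSetting` / `OncePuncturedTemperedGroup`; so far the tree inhabits it only by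
`isProfiniteCompletion_id_GQp` (the identity of `G_{ℚ_p}`) and by the chart maps of [SemiAnbd] Prop. 3.6
(iii).  An explicit MODEL of these interfaces (vacuity lane; e.g. abc-iut-L2-t1's root model with
`Π^tp := F₂ × G`, `Π := F̂₂ × Ĝ`) needs the two classical bricks proved here:
* `IsProfiniteCompletion.exists_openNormal_comap_eq` — the one lemma behind both: for `ι : F → F̂`
  with dense range into a topological group and an open normal `K ⊴ F̂` with `ι⁻¹(K) ≤ U ⊴ F`, the
  subgroup `V := K · ι(U)` is OPEN NORMAL in `F̂` with `ι⁻¹(V) = U`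
  (`surjective_mk_comp_of_denseRange`: `F → F̂ → F̂/K` is onto);
* `isProfiniteCompletion_of_eta` — for a DISCRETE group `F`, every `ι : F →ₜ* F̂` that agrees pointwise
  with Mathlib's `ProfiniteGrp.ProfiniteCompletion.etaFn` (`F̂ = completion (GrpCat.of F)`, the limit of
  the finite quotients) satisfies `IsProfiniteCompletion ι` (hypothesis-parametrised in `ι`, so a model's
  own `toHat` instantiates it with `fun _ => rfl`);
* `IsProfiniteCompletion.prodMap` — `IsProfiniteCompletion ι₁ → IsProfiniteCompletion ι₂ →
  IsProfiniteCompletion (ι₁.prodMap ι₂)` (an open normal subgroup of finite index of `F₁ × F₂` contains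
  `(U ∩ F₁) × (U ∩ F₂)`), and the corollary `isProfiniteCompletion_prodMap_of_eta` for two discrete groups.
HONEST FRAMING: classical profinite group theory (Ribes–Zalesskii, *Profinite Groups*, §3.2); nothing of
[SemiAnbd]/[EtTh] is asserted; no side is taken on any disputed claim.
-/

noncomputable section

open Topology Function

universe u v w

namespace Literature.AnabelianGeometry.SemiGraphs

namespace IsProfiniteCompletion

variable {F : Type u} {Fh : Type v} [Group F] [TopologicalSpace F] [Group Fh] [TopologicalSpace Fh]

/-- For `ι : F → F̂` with dense range and `K ≤ F̂` an open subgroup, the composite `F → F̂ → F̂/K` is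
surjective: the open coset `y·K` meets the image of `ι` ([SemiAnbd] §6 p. 69, profinite completions;
classical). [cite: MochizukiSemiAnbd2006, §6 p.69] -/
theorem surjective_mk_comp_of_denseRange [IsTopologicalGroup Fh] (ι : F →ₜ* Fh) (hd : DenseRange ι)
    (K : Subgroup Fh) [K.Normal] (hK : IsOpen (K : Set Fh)) :
    Surjective ((QuotientGroup.mk' K).comp ι.toMonoidHom) := by
  intro q
  obtain ⟨y, rfl⟩ := QuotientGroup.mk'_surjective K q
  -- the open set `y · K` (preimage of `K` under `z ↦ y⁻¹ * z`) meets the range of `ι`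
  have hopen : IsOpen ((fun z : Fh => y⁻¹ * z) ⁻¹' (K : Set Fh)) :=
    hK.preimage (continuous_const.mul continuous_id)
  have hne : ((fun z : Fh => y⁻¹ * z) ⁻¹' (K : Set Fh)).Nonempty :=
    ⟨y, by simp [K.one_mem]⟩
  obtain ⟨x, hx⟩ := hd.exists_mem_open hopen hne
  refine ⟨x, ?_⟩
  change (QuotientGroup.mk (ι x) : Fh ⧸ K) = QuotientGroup.mk y
  rw [QuotientGroup.eq]
  -- `(ι x)⁻¹ * y ∈ K` since `y⁻¹ * ι x ∈ K`
  have : y⁻¹ * ι x ∈ K := hx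
  simpa using K.inv_mem this

/-- **The one lemma behind both constructors.**  Let `ι : F → F̂` be a continuous homomorphism with
dense range into a topological group, `K ⊴ F̂` an open normal subgroup and `U ⊴ F` a normal subgroup with
`ι⁻¹(K) ≤ U`.  Then there is an open normal subgroup `V ⊴ F̂` with `ι⁻¹(V) = U`, namely
`V := K · ι(U)` = the preimage in `F̂` of the image of `U` in the finite group `F̂/K` (normal because
`F → F̂/K` is onto) ([SemiAnbd] §6 p. 69: open normal subgroups of `F` of finite index "are" those of
`F̂`; classical). [cite: MochizukiSemiAnbd2006, §6 p.69] -/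
theorem exists_openNormal_comap_eq [IsTopologicalGroup Fh] (ι : F →ₜ* Fh) (hd : DenseRange ι)
    (K : OpenNormalSubgroup Fh) (U : Subgroup F) [hU : U.Normal]
    (hKU : K.toSubgroup.comap ι.toMonoidHom ≤ U) :
    ∃ V : OpenNormalSubgroup Fh, U = V.toSubgroup.comap ι.toMonoidHom := by
  haveI : K.toSubgroup.Normal := K.isNormal'
  let π : Fh →* Fh ⧸ K.toSubgroup := QuotientGroup.mk' K.toSubgroup
  let φ : F →* Fh ⧸ K.toSubgroup := π.comp ι.toMonoidHom
  have hφ : Surjective φ := surjective_mk_comp_of_denseRange ι hd K.toSubgroup K.isOpen'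
  -- `V := π⁻¹(φ(U))`
  let W : Subgroup (Fh ⧸ K.toSubgroup) := U.map φ
  haveI hW : W.Normal := hU.map φ hφ
  let V : Subgroup Fh := W.comap π
  have hKV : K.toSubgroup ≤ V := by
    intro k hk
    change π k ∈ W
    have : π k = 1 := (QuotientGroup.eq_one_iff k).mpr hk
    rw [this]
    exact W.one_mem
  have hVopen : IsOpen (V : Set Fh) := Subgroup.isOpen_mono hKV K.isOpen'
  haveI hVn : V.Normal := Subgroup.Normal.comap hW π
  refine ⟨⟨⟨V, hVopen⟩, hVn⟩, ?_⟩
  -- `ι⁻¹(V) = φ⁻¹(φ(U)) = U ⊔ ker φ = U` since `ker φ = ι⁻¹(K) ≤ U`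
  change U = (W.comap π).comap ι.toMonoidHom
  rw [Subgroup.comap_comap]
  change U = Subgroup.comap φ (Subgroup.map φ U)
  rw [Subgroup.comap_map_eq]
  have hker : φ.ker ≤ U := by
    intro x hx
    apply hKU
    change ι x ∈ K.toSubgroup
    have : π (ι x) = 1 := hx
    exact (QuotientGroup.eq_one_iff _).mp this
  exact (sup_eq_left.mpr hker).symm

end IsProfiniteCompletion

/-! ### Mathlib's profinite completion of a discrete group -/

section Eta

open CategoryTheory ProfiniteGrp ProfiniteGrp.ProfiniteCompletion
open Literature.AnabelianGeometry.EtaleTheta.DiscreteNormalizers (continuous_val exists_proj)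

variable {F : Type u} [Group F] [TopologicalSpace F] [DiscreteTopology F]

/-- **Mathlib's profinite completion of a discrete group IS a profinite completion in the sense of the
L3 interface**: for `F` discrete and any continuous homomorphism `ι : F → F̂ := completion (GrpCat.of F)`
(the projective limit of the finite quotients `F/N`) agreeing pointwise with
`ProfiniteGrp.ProfiniteCompletion.etaFn`, `IsProfiniteCompletion ι` holds: `F̂` is profinite, `ι` has
dense range (Mathlib `ProfiniteCompletion.denseRange`), every normal subgroup `N ⊴ F` of finite index is
`ι⁻¹` of the open normal subgroup `Ker(F̂ → F/N)`, and preimages of open subgroups are open (`F` is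
discrete) ([SemiAnbd] §6 p. 69 "the profinite completion of a group"; Ribes–Zalesskii §3.2).
[cite: MochizukiSemiAnbd2006, §6 p.69] -/
theorem isProfiniteCompletion_of_eta (ι : F →ₜ* completion (GrpCat.of F))
    (hι : ∀ g : F, ι g = etaFn (GrpCat.of F) g) :
    IsProfiniteCompletion ι := by
  have hcoe : (ι : F → completion (GrpCat.of F)) = etaFn (GrpCat.of F) := funext hι
  refine
    { compactSpace := inferInstance
      t2Space := inferInstance
      totallyDisconnectedSpace := inferInstance
      denseRange := by rw [hcoe]; exact ProfiniteCompletion.denseRange (GrpCat.of F)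
      comap_surjective := fun U hUfi => ?_
      isOpen_comap := fun V => isOpen_discrete _ }
  haveI : U.toSubgroup.Normal := U.isNormal'
  haveI : U.toSubgroup.FiniteIndex := hUfi
  -- the finite-index normal subgroup `N := U` indexes a component of the limit
  let N : FiniteIndexNormalSubgroup F := { toSubgroup := U.toSubgroup }
  obtain ⟨π, hπ⟩ := exists_proj (F := F) N
  -- `K := Ker(F̂ → F/N)` is open (the component map is continuous into a discrete group) and normal
  haveI : DiscreteTopology ((diagram (GrpCat.of F)).obj N) := ⟨rfl⟩
  have hKopen : IsOpen (π.ker : Set (completion (GrpCat.of F))) := by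
    have : (π.ker : Set (completion (GrpCat.of F))) =
        (fun x : completion (GrpCat.of F) => x.val N) ⁻¹' {x | x = 1} := by
      ext x
      simp only [SetLike.mem_coe, MonoidHom.mem_ker, Set.mem_preimage, Set.mem_setOf_eq, hπ]
      rfl
    rw [this]
    exact (isOpen_discrete _).preimage (continuous_val N)
  let K : OpenNormalSubgroup (completion (GrpCat.of F)) := ⟨⟨π.ker, hKopen⟩, inferInstance⟩
  -- `ι⁻¹(K) = N = U` exactly
  have hKU : K.toSubgroup.comap ι.toMonoidHom ≤ U.toSubgroup := by
    intro x hx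
    have h1 : π (ι x) = 1 := hx
    rw [hπ, hι] at h1
    change ((QuotientGroup.mk x : F ⧸ N.toSubgroup)) = 1 at h1
    exact (QuotientGroup.eq_one_iff x).mp h1
  exact IsProfiniteCompletion.exists_openNormal_comap_eq ι
    (by rw [hcoe]; exact ProfiniteCompletion.denseRange (GrpCat.of F)) K U.toSubgroup hKU

end Eta

/-! ### Products -/

namespace IsProfiniteCompletion

variable {F₁ : Type u} {F₂ : Type v} {Fh₁ : Type w} {Fh₂ : Type w}
  [Group F₁] [TopologicalSpace F₁] [Group F₂] [TopologicalSpace F₂]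
  [Group Fh₁] [TopologicalSpace Fh₁] [Group Fh₂] [TopologicalSpace Fh₂]

/-- **Products of profinite completions are profinite completions**: if `ι₁ : F₁ → F̂₁` and
`ι₂ : F₂ → F̂₂` satisfy `IsProfiniteCompletion` (targets topological groups), so does
`ι₁ × ι₂ : F₁ × F₂ → F̂₁ × F̂₂` — the product is profinite, `ι₁ × ι₂` has dense range, and an open
normal subgroup `U ⊴ F₁ × F₂` of finite index contains `(U ∩ F₁) × (U ∩ F₂)`, each factor open normal
of finite index, hence cut out by open normal `V₁, V₂`; then `exists_openNormal_comap_eq` with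
`K := V₁ × V₂` ([SemiAnbd] §6 p. 69; Ribes–Zalesskii §3.2). [cite: MochizukiSemiAnbd2006, §6 p.69] -/
theorem prodMap [IsTopologicalGroup Fh₁] [IsTopologicalGroup Fh₂] {ι₁ : F₁ →ₜ* Fh₁} {ι₂ : F₂ →ₜ* Fh₂}
    (h₁ : IsProfiniteCompletion ι₁) (h₂ : IsProfiniteCompletion ι₂) :
    IsProfiniteCompletion (ι₁.prodMap ι₂) := by
  haveI := h₁.compactSpace; haveI := h₂.compactSpace
  haveI := h₁.t2Space; haveI := h₂.t2Space
  haveI := h₁.totallyDisconnectedSpace; haveI := h₂.totallyDisconnectedSpace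
  have hcoe : ((ι₁.prodMap ι₂ : (F₁ × F₂) →ₜ* (Fh₁ × Fh₂)) : F₁ × F₂ → Fh₁ × Fh₂) = Prod.map ι₁ ι₂ :=
    rfl
  have hdense : DenseRange (ι₁.prodMap ι₂) := by
    rw [hcoe]; exact h₁.denseRange.prodMap h₂.denseRange
  refine
    { compactSpace := inferInstance
      t2Space := inferInstance
      totallyDisconnectedSpace := inferInstance
      denseRange := hdense
      comap_surjective := fun U hUfi => ?_
      isOpen_comap := fun V => V.isOpen'.preimage (map_continuous (ι₁.prodMap ι₂)) }
  haveI : U.toSubgroup.Normal := U.isNormal'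
  haveI : U.toSubgroup.FiniteIndex := hUfi
  -- the slices `U₁ := {a | (a,1) ∈ U}`, `U₂ := {b | (1,b) ∈ U}`: open, normal, of finite index
  let U₁ : Subgroup F₁ := U.toSubgroup.comap (MonoidHom.inl F₁ F₂)
  let U₂ : Subgroup F₂ := U.toSubgroup.comap (MonoidHom.inr F₁ F₂)
  have hU₁o : IsOpen (U₁ : Set F₁) :=
    U.isOpen'.preimage (continuous_id.prodMk continuous_const)
  have hU₂o : IsOpen (U₂ : Set F₂) :=
    U.isOpen'.preimage (continuous_const.prodMk continuous_id)
  haveI hU₁n : U₁.Normal := Subgroup.Normal.comap inferInstance _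
  haveI hU₂n : U₂.Normal := Subgroup.Normal.comap inferInstance _
  have hU₁f : U₁.FiniteIndex := by
    refine ⟨fun h0 => ?_⟩
    have hd := Subgroup.relIndex_dvd_index_of_normal U.toSubgroup (MonoidHom.inl F₁ F₂).range
    rw [← Subgroup.index_comap] at hd
    exact hUfi.index_ne_zero (Nat.eq_zero_of_zero_dvd (h0 ▸ hd))
  have hU₂f : U₂.FiniteIndex := by
    refine ⟨fun h0 => ?_⟩
    have hd := Subgroup.relIndex_dvd_index_of_normal U.toSubgroup (MonoidHom.inr F₁ F₂).range
    rw [← Subgroup.index_comap] at hd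
    exact hUfi.index_ne_zero (Nat.eq_zero_of_zero_dvd (h0 ▸ hd))
  obtain ⟨V₁, hV₁⟩ := h₁.comap_surjective ⟨⟨U₁, hU₁o⟩, hU₁n⟩ hU₁f
  obtain ⟨V₂, hV₂⟩ := h₂.comap_surjective ⟨⟨U₂, hU₂o⟩, hU₂n⟩ hU₂f
  change U₁ = V₁.toSubgroup.comap ι₁.toMonoidHom at hV₁
  change U₂ = V₂.toSubgroup.comap ι₂.toMonoidHom at hV₂
  -- `K := V₁ × V₂`, open normal in `F̂₁ × F̂₂`, with `(ι₁ × ι₂)⁻¹(K) = U₁ × U₂ ≤ U`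
  haveI : V₁.toSubgroup.Normal := V₁.isNormal'
  haveI : V₂.toSubgroup.Normal := V₂.isNormal'
  let K : OpenNormalSubgroup (Fh₁ × Fh₂) :=
    ⟨⟨V₁.toSubgroup.prod V₂.toSubgroup, V₁.isOpen'.prod V₂.isOpen'⟩, inferInstance⟩
  have hKU : K.toSubgroup.comap (ι₁.prodMap ι₂).toMonoidHom ≤ U.toSubgroup := by
    rintro ⟨a, b⟩ hab
    have ha : a ∈ U₁ := by
      rw [hV₁]; exact hab.1
    have hb : b ∈ U₂ := by
      rw [hV₂]; exact hab.2
    have := U.toSubgroup.mul_mem ha hb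
    simpa using this
  exact exists_openNormal_comap_eq (ι₁.prodMap ι₂) hdense K U.toSubgroup hKU

end IsProfiniteCompletion

section EtaProd

open CategoryTheory ProfiniteGrp ProfiniteGrp.ProfiniteCompletion

/-- **The product of Mathlib's profinite-completion maps of two discrete groups is a profinite
completion** of the product: for `F₁, F₂` discrete and `ιᵢ : Fᵢ → F̂ᵢ` agreeing with `etaFn`,
`IsProfiniteCompletion (ι₁ × ι₂)` — the field `isProfiniteCompletion_toHat` of a product model
`Π^tp := F₁ × F₂ ↪ F̂₁ × F̂₂ =: Π` ([SemiAnbd] §6 p. 69; [EtTh] §1 p. 12 "`Π_X := (Π^tp_X)^∧`").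
[cite: MochizukiSemiAnbd2006, §6 p.69] -/
theorem isProfiniteCompletion_prodMap_of_eta {F₁ F₂ : Type u} [Group F₁] [TopologicalSpace F₁]
    [DiscreteTopology F₁] [Group F₂] [TopologicalSpace F₂] [DiscreteTopology F₂]
    (ι₁ : F₁ →ₜ* completion (GrpCat.of F₁)) (hι₁ : ∀ g, ι₁ g = etaFn (GrpCat.of F₁) g)
    (ι₂ : F₂ →ₜ* completion (GrpCat.of F₂)) (hι₂ : ∀ g, ι₂ g = etaFn (GrpCat.of F₂) g) :
    IsProfiniteCompletion (ι₁.prodMap ι₂) :=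
  (isProfiniteCompletion_of_eta ι₁ hι₁).prodMap (isProfiniteCompletion_of_eta ι₂ hι₂)

end EtaProd

end Literature.AnabelianGeometry.SemiGraphs

end
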